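/-
Copyright (c) 2026 the pub-hodgecm-mathlib formalisation cell (harness21).  Prover seat hodgecm-mathlib-LH4-p09 (g11) (K1b desk K2Liu-p14 (g5) DESK WORD #11 (β)
«the ARCH HALF of `hBL₁`»), Track B «K2-LIT» ∕ hLiu418 socket #41 KIND 1, package (K1b-♮), letter (dec-2): THE ARCHIMEDEAN PER-PLACE FACTOR OF THE BLOCK LETTER —
the corner line-Whittaker integral at a block decomposition, bounded in the corner-row currency of ★ p864248.  THEOREMS ONLY.
-/
import Summits.HodgeConjecture.HodgeConjecture.Theorems.K2LiuKindOneLineCornerArchIwasawa   -- ★ (β-1) `exists_fourFactor_of_blockDecomp` (this seat)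
import Summits.HodgeConjecture.HodgeConjecture.Theorems.K2LiuKindOneLineCornerArchReading   -- ★ (e∞) p863005 `corner_lineWhittaker_iwasawa` (+ ★ p862865 line Iwasawa, ★ tube defs)
import Summits.HodgeConjecture.HodgeConjecture.Theorems.K2LiuKindOneLineWhittakerDecay      -- ★ (KW1-d) p862696 `exists_forall_norm_archLineWhittaker_le{,_neg}` (scalar-type line letters)
import HarnessLib

/-!
# Crux `HLiu418`, socket #41, KIND 1 — (dec-2)∕(β) `K2LiuKindOneLineCornerArchFactor`: THE ARCHIMEDEAN PER-PLACE FACTOR OF THE BLOCK LETTER `hBL₁`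

Cell `hodgecm-mathlib`, crux item hLiu418 = `stmt-HodgeConjecture-24832` (helper lane `--supports … --as helper`, count-neutral), route of record `HCCMUnconditional`;
squad K2 ∕ K2Liu; K1b desk K2Liu-p14 (g5) DESK WORD #11 (β) (2026-09-05T01:42:53Z).  THEOREMS ONLY (no `def`, no `instance`, no notation, no named-fact hypothesis,
no `sorry`).

THE POINT.  The block letter `hBL₁` of ★ p864248 `K2LiuKindOneLineDecayOneFrame.hdecF₀_of_blockLetter` bounds the line Whittaker coefficient of the corner translate by
`C·‖h‖^a·D^{a₂}·(1+τS)^{N₀} · ∏_σ ρ_σ^{e₁(s)} · ‖det Y_σ‖^{e₂(s)} · (1 + m_σ ρ_σ)^{Ng} · e^{−π m_σ ρ_σ}` with `ρ_σ = Σ_k ‖(Y_σ)_{1k}‖²` the square of the LINE's Levi coordinate read off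
a block decomposition `T_σ (x_∞)~ T_σ⁻¹ = [Y_σ, B_σ; 0, D_σ]·κ_σ` in the tube frame.  THIS FILE is the per-place archimedean factor, LOCALLY, in the tube frame of `U(2,2)`:
* §1 **`norm_corner_lineWhittaker_le_of_blockDecomp`** (HEAD) — for a Siegel section `f ∈ I_w(s,χ)` (`χ 1 = 1`, `‖χ‖ ≤ 1` off `0`) with a `K_w`-type letter (`f(g k) = ρ_k f(g)`,
  `‖ρ_k‖ ≤ 1`, for `k ∈ U(J)` fixing `i·1`) and a LINE letter for `f ∘ ι` at rate `π` (both BY VALUE), and `g = [Y, B; 0, D]·κ ∈ U(J)` with `κ` UNITARY: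
  `‖∫ f(ι(J₁ n₁(t)) · g) e^{−2πiμt} dt‖ ≤ C_L · ρ^{−(2 re s + 1)} · ‖det Y‖^{2 re s + 2} · ((1 + |μ|ρ) · e^{−π|μ|ρ})`, `ρ = Σ_j ‖Y 1 j‖²`
  (★ (β-1) four-factor form ∘ ★ (e∞) `corner_lineWhittaker_iwasawa` ∘ the two letters; `‖r‖^{2re s+2}·‖a₀₀‖^{−2re s} = ρ^{e₁}‖det Y‖^{e₂}`, `e₁ = −(2re s+1)`, `e₂ = 2re s+2`,
  `Ng = 1` — the per-σ factor of `hBL₁` token for token with `m := |μ|`);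
* §2 **`exists_norm_corner_lineWhittaker_archScalarSection_le`** — the DISCHARGE for the scalar types `k = 1, −1`: `K_w` letter by ★ `scalarSection_mul_stab`'s computation
  (+ ★ `norm_det_denom_of_stab`), line letter by ★ (KW1-d) at the line parameter `s + ½` (★ `archScalarSection_corner`): `∃ C r`, locally uniformly on `{0 < re z}` = `hBL₁`'s ball.
MOVER CLASS.  `hBL₁` as typed quantifies over all movers with `κκ′ = 1` and entries `≤ M`; the left side is mover-free while `ρ_σ` is not, so at the frozen rate `π` only the unitary
movers (those of ★ p862843's QR decomposition, `κ′ = star κ`) can be served — this file's class; the `M`-bounded class needs a payer-chosen rate (`π∕16M²`), cf. the K2 bus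
2026-09-05T01:51:05Z (2).
HONEST LABEL.  Count-neutral helper, hypothesis-first in the two letters; closes no socket: `HC_CM` is proved only modulo the 7 printed citations (2 remaining named inputs: hLiu418 =
`stmt-HodgeConjecture-24832`, h413 = `stmt-HodgeConjecture-24833`) until rung 0 closes.  NOT here: the blk ↔ archAt dictionary (`T_σ (Λ₀ĝ)~ T_σ⁻¹ = fromBlocks ĝ^φ 0 0 ·`,
then ★ (dec-3c) `blockDecomp_mul_of_diag` gives `Y = ĝ^φ·A`), the finite half and ★ (dec-1)'s Euler transfer (the KW-fin residue), the line types `|k| ≥ 3`.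
[Shimura1997, §16, §18.4]; [KudlaRallis1994, §2]; [BorelJacquet1979, §1.2, §4.1]; [MoeglinWaldspurger1995, II.1.5, II.1.7]; [Bump1997, §1.6, §3.7].
-/

set_option autoImplicit false
set_option linter.dupNamespace false -- the mandated namespace repeats `HodgeConjecture.HodgeConjecture`

noncomputable section

namespace Summit.HodgeConjecture.HodgeConjecture.Cruxes.HLiu418.K2LiuKindOneLineCornerArchFactor

open Matrix Complex MeasureTheory
open scoped ComplexConjugate Matrix BigOperators
open Literature.NumberTheory.ModularForms.SiegelUpperHalfSpace (moeb denom)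
open Summit.HodgeConjecture.HodgeConjecture.Cruxes.HLiu418.K2LiuArchInducedTubeDefs (IsArchSiegelSection archScalarSection archScalarSection_apply)
open Summit.HodgeConjecture.HodgeConjecture.Cruxes.HLiu418.K2LiuArchInducedTubeSection (isArchSiegelSection_archScalarSection)
open Summit.HodgeConjecture.HodgeConjecture.Cruxes.HLiu418.K2LiuArchInducedTubeSectionPrelims (norm_det_denom_of_stab)
open Summit.HodgeConjecture.HodgeConjecture.Cruxes.HLiu418.K2LiuHermitianTubeCocycle (det_denom_mul_of_posDef posDef_im_I_smul_one)
open Summit.HodgeConjecture.HodgeConjecture.Cruxes.HLiu418.K2LiuKindOneLineCornerArchIwasawa (exists_fourFactor_of_blockDecomp)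
open Summit.HodgeConjecture.HodgeConjecture.Cruxes.HLiu418.K2LiuKindOneLineCornerArchReading (corner_lineWhittaker_iwasawa archScalarSection_corner)
open Summit.HodgeConjecture.HodgeConjecture.Cruxes.HLiu418.K2LiuKindOneLineWhittakerIwasawa (norm_chiK_eq_one norm_exp_phase)
open Summit.HodgeConjecture.HodgeConjecture.Cruxes.HLiu418.K2LiuKindOneLineWhittakerDecay (exists_forall_norm_archLineWhittaker_le exists_forall_norm_archLineWhittaker_neg_le)

/-! ## §1 The per-place factor at a unitary-mover block decomposition -/

section Head

variable (ι : Matrix (Fin 1 ⊕ Fin 1) (Fin 1 ⊕ Fin 1) ℂ → Matrix (Fin 2 ⊕ Fin 2) (Fin 2 ⊕ Fin 2) ℂ)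
    (hι : ∀ x, ι x = fromBlocks !![1, 0; 0, x (Sum.inl 0) (Sum.inl 0)] !![0, 0; 0, x (Sum.inl 0) (Sum.inr 0)] !![0, 0; 0, x (Sum.inr 0) (Sum.inl 0)] !![1, 0; 0, x (Sum.inr 0) (Sum.inr 0)])

/-- rpow bookkeeping: `‖r‖^{2x+2} · n^{−2x} = (n²)^{−(2x+1)} · (‖r‖ n)^{2x+2}` for `n > 0`, `‖r‖ ≥ 0` — the passage from the four-factor coordinates `(r, a₀₀ = n)` to the corner-row
currency `(ρ = n², ‖det Y‖ = ‖r‖ n)`. [folklore] -/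
theorem rpow_bookkeeping {R n : ℝ} (hR : 0 ≤ R) (hn : 0 < n) (x : ℝ) :
    R ^ (2 * x + 2) * n ^ (-(2 * x)) = (n ^ 2) ^ (-(2 * x + 1)) * (R * n) ^ (2 * x + 2) := by
  have hn0 : 0 ≤ n := hn.le
  rw [Real.mul_rpow hR hn0, show ((n ^ 2 : ℝ)) = n ^ (2 : ℝ) by rw [Real.rpow_two], ← Real.rpow_mul hn0]
  have h : n ^ (-(2 * x)) = n ^ (2 * -(2 * x + 1)) * n ^ (2 * x + 2) := by
    rw [← Real.rpow_add hn]; congr 1; ring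
  rw [h]; ring

include hι in
/-- **THE ARCHIMEDEAN PER-PLACE FACTOR OF THE BLOCK LETTER (HEAD).**  Tube frame of `U(2,2)` (`J = Matrix.J (Fin 2) ℂ`), corner map `ι` BY VALUE (the line on the second index);
`f ∈ I_w(s, χ)` a Siegel section with `χ 1 = 1` and `‖χ z‖ ≤ 1` (`z ≠ 0`); the `K_w`-TYPE LETTER BY VALUE `hK` (every `k ∈ U(J)` fixing `i·1` acts on `f` by a scalar of norm `≤ 1`;
scalar types: §2); the LINE LETTER BY VALUE `hline` (rate `π`, any constant `C_L`; scalar types: ★ (KW1-d)); a point `g = [Y, B; 0, D] · κ ∈ U(J)` with a UNITARY mover `κ`.  THEN for every real `μ`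
`‖∫ f(ι(J₁ n₁(t)) · g) e^{−2πiμt} dt‖ ≤ C_L · ρ^{−(2 re s+1)} · ‖det Y‖^{2 re s+2} · ((1 + |μ| ρ) · e^{−π |μ| ρ})`, `ρ = Σ_j ‖Y 1 j‖²` — ★ (β-1) `exists_fourFactor_of_blockDecomp`
(`‖a₀₀‖² = ρ`, `‖r‖ ‖a₀₀‖ = ‖det Y‖`), ★ (e∞) `corner_lineWhittaker_iwasawa`, `|e^{2πiμb₀}| = 1`, the two letters.  [cite: Shimura1997, §16, §18.4] [cite: KudlaRallis1994, §2]
[cite: BorelJacquet1979, §1.2, §4.1] [cite: MoeglinWaldspurger1995, II.1.5, II.1.7] -/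
theorem norm_corner_lineWhittaker_le_of_blockDecomp
    {χ : ℂ → ℂ} {s : ℂ} {f : Matrix (Fin 2 ⊕ Fin 2) (Fin 2 ⊕ Fin 2) ℂ → ℂ} (hf : IsArchSiegelSection χ s f) (hχ1 : χ 1 = 1)
    (hχ : ∀ z : ℂ, z ≠ 0 → ‖χ z‖ ≤ 1)
    (hK : ∀ k : Matrix (Fin 2 ⊕ Fin 2) (Fin 2 ⊕ Fin 2) ℂ, kᴴ * Matrix.J (Fin 2) ℂ * k = Matrix.J (Fin 2) ℂ →
      moeb k (I • (1 : Matrix (Fin 2) (Fin 2) ℂ)) = I • 1 → ∃ ρ : ℂ, ‖ρ‖ ≤ 1 ∧ ∀ g, f (g * k) = ρ * f g)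
    {CL : ℝ}
    (hline : ∀ h : ℝ, ‖∫ t : ℝ, f (ι (Matrix.J (Fin 1) ℂ * fromBlocks 1 ((t : ℂ) • (1 : Matrix (Fin 1) (Fin 1) ℂ)) 0 1)) *
        Complex.exp (-(2 * Real.pi * I * h * t))‖ ≤ CL * (1 + |h|) * Real.exp (-(Real.pi * |h|)))
    {Y B D : Matrix (Fin 2) (Fin 2) ℂ} {κ : Matrix (Fin 2 ⊕ Fin 2) (Fin 2 ⊕ Fin 2) ℂ}
    (hg : (fromBlocks Y B 0 D * κ)ᴴ * Matrix.J (Fin 2) ℂ * (fromBlocks Y B 0 D * κ) = Matrix.J (Fin 2) ℂ) (hκ : κ * κᴴ = 1) (hκ' : κᴴ * κ = 1) (μ : ℝ) :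
    ‖∫ t : ℝ, f (ι (Matrix.J (Fin 1) ℂ * fromBlocks 1 ((t : ℂ) • (1 : Matrix (Fin 1) (Fin 1) ℂ)) 0 1) * (fromBlocks Y B 0 D * κ)) *
        Complex.exp (-(2 * Real.pi * I * μ * t))‖ ≤
      CL * (∑ j, ‖Y 1 j‖ ^ 2) ^ (-(2 * s.re + 1)) * ‖Y.det‖ ^ (2 * s.re + 2) *
        ((1 + |μ| * ∑ j, ‖Y 1 j‖ ^ 2) * Real.exp (-(Real.pi * (|μ| * ∑ j, ‖Y 1 j‖ ^ 2)))) := by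
  obtain ⟨r, u, c, b, b₀, n, k, hr, hn, hkJ, hkI, -, hfour, hn2, hrn⟩ := exists_fourFactor_of_blockDecomp hg hκ hκ'
  obtain ⟨ρk, hρk, hfk⟩ := hK k hkJ hkI
  have hnC : (n : ℂ) ≠ 0 := ofReal_ne_zero.2 hn.ne'
  -- the line's Levi pair `a = (n)`, `d = (n⁻¹)` and the corner factor written through `ι`
  set a : Matrix (Fin 1) (Fin 1) ℂ := !![(n : ℂ)] with ha_def
  set d : Matrix (Fin 1) (Fin 1) ℂ := !![((n : ℂ))⁻¹] with hd_def
  have ha00 : a 0 0 = (n : ℂ) := by simp [ha_def]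
  have hd00 : d 0 0 = ((n : ℂ))⁻¹ := by simp [hd_def]
  have had : aᴴ * d = 1 := by
    ext i j
    fin_cases i; fin_cases j
    simp [Matrix.mul_apply, conjTranspose_apply, ha_def, hd_def, hnC]
  have hι4 : ι (fromBlocks 1 ((b₀ : ℂ) • (1 : Matrix (Fin 1) (Fin 1) ℂ)) 0 1 * fromBlocks a 0 0 d) =
      fromBlocks !![1, 0; 0, (n : ℂ)] !![0, 0; 0, (b₀ : ℂ) * (n : ℂ)⁻¹] 0 !![1, 0; 0, (n : ℂ)⁻¹] := by
    rw [hι, fromBlocks_multiply]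
    ext i j
    rcases i with i | i <;> rcases j with j | j <;> fin_cases i <;> fin_cases j <;> simp [ha_def, hd_def, fromBlocks]
  have key := corner_lineWhittaker_iwasawa ι hι hf hχ1 hr u c b had b₀ hfk μ
  rw [hι4] at key
  rw [hfour, key]
  -- sizes
  have hna : ‖a 0 0‖ = n := by rw [ha00, Complex.norm_real, Real.norm_of_nonneg hn.le]
  have hrpos : 0 < ‖r‖ := norm_pos_iff.2 hr
  have hd0 : d 0 0 ≠ 0 := by rw [hd00]; exact inv_ne_zero hnC
  have hL := hline (‖a 0 0‖ ^ 2 * μ)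
  rw [hna] at hL
  have habs : |n ^ 2 * μ| = |μ| * n ^ 2 := by rw [abs_mul, abs_of_nonneg (sq_nonneg n), mul_comm]
  rw [habs] at hL
  have e1 : ‖((‖r‖ : ℝ) : ℂ) ^ (2 * s + 2)‖ = ‖r‖ ^ (2 * s.re + 2) := by
    rw [Complex.norm_cpow_eq_rpow_re_of_pos hrpos]; simp
  have e2 : ‖((‖a 0 0‖ : ℝ) : ℂ) ^ (1 - 2 * (s + 1 / 2))‖ = n ^ (-(2 * s.re)) := by
    rw [hna, Complex.norm_cpow_eq_rpow_re_of_pos hn]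
    congr 1
    simp; ring
  have hI0 : 0 ≤ ‖∫ t : ℝ, f (ι (Matrix.J (Fin 1) ℂ * fromBlocks 1 ((t : ℂ) • (1 : Matrix (Fin 1) (Fin 1) ℂ)) 0 1)) *
      Complex.exp (-(2 * Real.pi * I * ((n ^ 2 * μ : ℝ) : ℂ) * t))‖ := norm_nonneg _
  calc ‖ρk * (χ r * ((‖r‖ : ℝ) : ℂ) ^ (2 * s + 2)) *
          (Complex.exp (2 * Real.pi * I * μ * b₀) * (χ (d 0 0) * ((‖a 0 0‖ : ℝ) : ℂ) ^ (1 - 2 * (s + 1 / 2))) *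
            ∫ t : ℝ, f (ι (Matrix.J (Fin 1) ℂ * fromBlocks 1 ((t : ℂ) • (1 : Matrix (Fin 1) (Fin 1) ℂ)) 0 1)) *
              Complex.exp (-(2 * Real.pi * I * ((‖a 0 0‖ ^ 2 * μ : ℝ) : ℂ) * t)))‖
      = ‖ρk‖ * ‖χ r‖ * ‖r‖ ^ (2 * s.re + 2) * ‖χ (d 0 0)‖ * n ^ (-(2 * s.re)) *
          ‖∫ t : ℝ, f (ι (Matrix.J (Fin 1) ℂ * fromBlocks 1 ((t : ℂ) • (1 : Matrix (Fin 1) (Fin 1) ℂ)) 0 1)) *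
              Complex.exp (-(2 * Real.pi * I * ((n ^ 2 * μ : ℝ) : ℂ) * t))‖ := by
        rw [norm_mul, norm_mul, norm_mul, norm_mul, norm_mul, norm_mul, norm_exp_phase, one_mul, e1, e2, hna]
        ring
    _ ≤ 1 * 1 * ‖r‖ ^ (2 * s.re + 2) * 1 * n ^ (-(2 * s.re)) * (CL * (1 + |μ| * n ^ 2) * Real.exp (-(Real.pi * (|μ| * n ^ 2)))) := by
        gcongr
        · exact hχ r hr
        · exact hχ _ hd0
    _ = CL * ((n ^ 2) ^ (-(2 * s.re + 1)) * (‖r‖ * n) ^ (2 * s.re + 2)) * ((1 + |μ| * n ^ 2) * Real.exp (-(Real.pi * (|μ| * n ^ 2)))) := by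
        rw [← rpow_bookkeeping (norm_nonneg r) hn]; ring
    _ = _ := by rw [hn2, hrn]; ring

end Head

/-! ## §2 The discharge for the scalar types `k = ±1` -/

section Scalar

variable (ι : Matrix (Fin 1 ⊕ Fin 1) (Fin 1 ⊕ Fin 1) ℂ → Matrix (Fin 2 ⊕ Fin 2) (Fin 2 ⊕ Fin 2) ℂ)
    (hι : ∀ x, ι x = fromBlocks !![1, 0; 0, x (Sum.inl 0) (Sum.inl 0)] !![0, 0; 0, x (Sum.inl 0) (Sum.inr 0)] !![0, 0; 0, x (Sum.inr 0) (Sum.inl 0)] !![1, 0; 0, x (Sum.inr 0) (Sum.inr 0)])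

/-- **THE `K_w`-TYPE LETTER OF THE SCALAR TYPES, for every `g`**: `f⁰_{s,k}(g u) = j(u, i1)^{−k} · f⁰_{s,k}(g)` for `u ∈ U(J)` fixing `i·1` (★ `scalarSection_mul_stab`'s computation
without its unused `g ∈ U(J)` hypothesis: the cocycle ★ `det_denom_mul_of_posDef` and `‖j(u,i1)‖ = 1`). [cite: Shimura1997, §16.4] -/
theorem archScalarSection_mul_stab_all {l : Type*} [Fintype l] [DecidableEq l] (k : ℤ) (s : ℂ) {u : Matrix (l ⊕ l) (l ⊕ l) ℂ}
    (hU : uᴴ * Matrix.J l ℂ * u = Matrix.J l ℂ) (hI : moeb u (I • (1 : Matrix l l ℂ)) = I • 1) (g : Matrix (l ⊕ l) (l ⊕ l) ℂ) :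
    archScalarSection k s (g * u) = (denom u (I • (1 : Matrix l l ℂ))).det ^ (-k) * archScalarSection k s g := by
  rw [archScalarSection_apply, archScalarSection_apply, det_denom_mul_of_posDef hU posDef_im_I_smul_one, hI, norm_mul,
    norm_det_denom_of_stab hU hI, mul_one, mul_zpow]
  ring

/-- the `K_w` letter of §1 for the scalar types: the multiplier `j(u,i1)^{−k}` has norm `1`. [cite: Shimura1997, §16.4] -/
theorem scalar_hK (k : ℤ) (s : ℂ) (u : Matrix (Fin 2 ⊕ Fin 2) (Fin 2 ⊕ Fin 2) ℂ) (hU : uᴴ * Matrix.J (Fin 2) ℂ * u = Matrix.J (Fin 2) ℂ)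
    (hI : moeb u (I • (1 : Matrix (Fin 2) (Fin 2) ℂ)) = I • 1) :
    ∃ ρ : ℂ, ‖ρ‖ ≤ 1 ∧ ∀ g, archScalarSection k s (g * u) = ρ * archScalarSection k s g := by
  refine ⟨(denom u (I • (1 : Matrix (Fin 2) (Fin 2) ℂ))).det ^ (-k), ?_, archScalarSection_mul_stab_all k s hU hI⟩
  rw [norm_zpow, norm_det_denom_of_stab hU hI, _root_.one_zpow]

/-- `χ_k(1) = 1` and `‖χ_k(z)‖ ≤ 1` off `0`, `χ_k(z) = (z̄∕‖z‖)^k`. [folklore] -/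
theorem chiK_one_and_norm_le (k : ℤ) :
    (fun z : ℂ => (conj z / ((‖z‖ : ℝ) : ℂ)) ^ k) 1 = 1 ∧ ∀ z : ℂ, z ≠ 0 → ‖(fun z : ℂ => (conj z / ((‖z‖ : ℝ) : ℂ)) ^ k) z‖ ≤ 1 := by
  refine ⟨by simp, fun z hz => ?_⟩
  simp only
  rw [norm_chiK_eq_one k hz]

include hι in
/-- **THE DISCHARGE FOR THE SCALAR TYPES `k = 1, −1` (locally uniform in `s`).**  For `re z > 0` there are `C ≥ 0`, `r > 0` with: for all `s`, `dist s z < r`, every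
`g = [Y, B; 0, D]·κ ∈ U(J)` with `κ` unitary and every real `μ`,
`‖∫ f⁰_{s,k}(ι(J₁ n₁(t)) · g) e^{−2πiμt} dt‖ ≤ C · ρ^{−(2 re s+1)} · ‖det Y‖^{2 re s+2} · ((1 + |μ|ρ) · e^{−π|μ|ρ})`, `ρ = Σ_j ‖Y 1 j‖²`
(§1 with the `K_w` letter `scalar_hK` and the line letter ★ (KW1-d) `exists_forall_norm_archLineWhittaker_le` ∕ `_neg_le` at the line parameter `s + ½` — `re (z + ½) > ½` —
through ★ `archScalarSection_corner`).  The ball `{0 < re z}` is `hBL₁`'s. [cite: Shimura1997, §16, §18.4] [cite: Bump1997, §1.6, §3.7] [cite: KudlaRallis1994, §2] -/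
theorem exists_norm_corner_lineWhittaker_archScalarSection_le {k : ℤ} (hk : k = 1 ∨ k = -1) {z : ℂ} (hz : 0 < z.re) :
    ∃ C r : ℝ, 0 ≤ C ∧ 0 < r ∧ ∀ s : ℂ, dist s z < r →
      ∀ (Y B D : Matrix (Fin 2) (Fin 2) ℂ) (κ : Matrix (Fin 2 ⊕ Fin 2) (Fin 2 ⊕ Fin 2) ℂ),
        (fromBlocks Y B 0 D * κ)ᴴ * Matrix.J (Fin 2) ℂ * (fromBlocks Y B 0 D * κ) = Matrix.J (Fin 2) ℂ → κ * κᴴ = 1 → κᴴ * κ = 1 → ∀ μ : ℝ,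
        ‖∫ t : ℝ, archScalarSection k s (ι (Matrix.J (Fin 1) ℂ * fromBlocks 1 ((t : ℂ) • (1 : Matrix (Fin 1) (Fin 1) ℂ)) 0 1) * (fromBlocks Y B 0 D * κ)) *
            Complex.exp (-(2 * Real.pi * I * μ * t))‖ ≤
          C * (∑ j, ‖Y 1 j‖ ^ 2) ^ (-(2 * s.re + 1)) * ‖Y.det‖ ^ (2 * s.re + 2) *
            ((1 + |μ| * ∑ j, ‖Y 1 j‖ ^ 2) * Real.exp (-(Real.pi * (|μ| * ∑ j, ‖Y 1 j‖ ^ 2)))) := by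
  have hz' : 1 / 2 < (z + 1 / 2).re := by simp; linarith
  -- the line letter at parameter `s + ½`, for the type `k`
  have hL : ∃ C r : ℝ, 0 ≤ C ∧ 0 < r ∧ ∀ s : ℂ, dist s (z + 1 / 2) < r → ∀ h : ℝ,
      ‖∫ β : ℝ, archScalarSection k s (Matrix.J (Fin 1) ℂ * Matrix.fromBlocks 1 ((β : ℂ) • (1 : Matrix (Fin 1) (Fin 1) ℂ)) 0 1) *
          Complex.exp (-(2 * Real.pi * Complex.I * h * β))‖ ≤ C * (1 + |h|) * Real.exp (-(Real.pi * |h|)) := by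
    rcases hk with rfl | rfl
    · exact exists_forall_norm_archLineWhittaker_le hz'
    · exact exists_forall_norm_archLineWhittaker_neg_le hz'
  obtain ⟨C, r, hC, hr, hb⟩ := hL
  refine ⟨C, r, hC, hr, fun s hs Y B D κ hg hκ hκ' μ => ?_⟩
  have hs' : dist (s + 1 / 2) (z + 1 / 2) < r := by rwa [dist_eq_norm, add_sub_add_right_eq_sub, ← dist_eq_norm]
  obtain ⟨hχ1, hχ⟩ := chiK_one_and_norm_le k
  have hline : ∀ h : ℝ, ‖∫ t : ℝ, archScalarSection k s (ι (Matrix.J (Fin 1) ℂ * fromBlocks 1 ((t : ℂ) • (1 : Matrix (Fin 1) (Fin 1) ℂ)) 0 1)) *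
      Complex.exp (-(2 * Real.pi * I * h * t))‖ ≤ C * (1 + |h|) * Real.exp (-(Real.pi * |h|)) := fun h => by
    simp_rw [archScalarSection_corner ι hι]
    exact hb (s + 1 / 2) hs' h
  exact norm_corner_lineWhittaker_le_of_blockDecomp ι hι (isArchSiegelSection_archScalarSection k s) hχ1 hχ (fun u hU hI => scalar_hK k s u hU hI) hline
    hg hκ hκ' μ

end Scalar

/-! ## §3 The line on the FIRST index (the A-line twin): the corner row is row `0` -/

section Inl

variable (ι : Matrix (Fin 1 ⊕ Fin 1) (Fin 1 ⊕ Fin 1) ℂ → Matrix (Fin 2 ⊕ Fin 2) (Fin 2 ⊕ Fin 2) ℂ)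
    (hι : ∀ x, ι x = fromBlocks !![1, 0; 0, x (Sum.inl 0) (Sum.inl 0)] !![0, 0; 0, x (Sum.inl 0) (Sum.inr 0)] !![0, 0; 0, x (Sum.inr 0) (Sum.inl 0)] !![1, 0; 0, x (Sum.inr 0) (Sum.inr 0)])
    (ι₀ : Matrix (Fin 1 ⊕ Fin 1) (Fin 1 ⊕ Fin 1) ℂ → Matrix (Fin 2 ⊕ Fin 2) (Fin 2 ⊕ Fin 2) ℂ)
    (hι₀ : ∀ x, ι₀ x = fromBlocks !![x (Sum.inl 0) (Sum.inl 0), 0; 0, 1] !![x (Sum.inl 0) (Sum.inr 0), 0; 0, 0] !![x (Sum.inr 0) (Sum.inl 0), 0; 0, 0] !![x (Sum.inr 0) (Sum.inr 0), 0; 0, 1])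

include hι hι₀ in
/-- **THE INDEX SWAP**: with `P = (0 1; 1 0)` and the Levi rotation `m(P,P) = fromBlocks P 0 0 P` (`∈ U(J)`, an involution), the FIRST-index corner map is the conjugate of the
second-index one: `ι₀(x) = m(P,P) · ι(x) · m(P,P)`. [folklore] [cite: Kudla1994, §2] -/
theorem cornerInl_eq_conj (x : Matrix (Fin 1 ⊕ Fin 1) (Fin 1 ⊕ Fin 1) ℂ) :
    ι₀ x = fromBlocks !![0, 1; 1, 0] 0 0 !![0, 1; 1, 0] * ι x * fromBlocks !![0, 1; 1, 0] 0 0 !![0, 1; 1, 0] := by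
  rw [hι₀, hι]
  ext i j
  rcases i with i | i <;> rcases j with j | j <;> fin_cases i <;> fin_cases j <;>
    simp [Matrix.mul_apply, Fintype.sum_sum_type, Fin.sum_univ_two, fromBlocks]

/-- `m(P,P) ∈ U(J)` for the swap `P`. [folklore] -/
theorem swap_levi_mem :
    (fromBlocks !![0, 1; 1, 0] 0 0 !![0, 1; 1, 0] : Matrix (Fin 2 ⊕ Fin 2) (Fin 2 ⊕ Fin 2) ℂ)ᴴ * Matrix.J (Fin 2) ℂ * fromBlocks !![0, 1; 1, 0] 0 0 !![0, 1; 1, 0] =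
      Matrix.J (Fin 2) ℂ := by
  refine (K2LiuHermitianTubeCocycle.levi_mem_iff _ _).2 ?_
  ext i j
  fin_cases i <;> fin_cases j <;> simp [Matrix.mul_apply, Fin.sum_univ_two, conjTranspose_apply]

include hι hι₀ in
/-- **THE A-LINE TWIN OF THE HEAD (the line on the FIRST index).**  Same letters as §1 (the `K_w`-type letter and the LINE letter for `f ∘ ι`); for `g = [Y, B; 0, D]·κ ∈ U(J)` with `κ`
unitary, the corner line-Whittaker integral through `ι₀` is bounded in the ROW-`0` currency:
`‖∫ f(ι₀(J₁ n₁(t)) · g) e^{−2πiμt} dt‖ ≤ C_L · ρ₀^{−(2 re s+1)} · ‖det Y‖^{2 re s+2} · ((1 + |μ|ρ₀) · e^{−π|μ|ρ₀})`, `ρ₀ = Σ_j ‖Y 0 j‖²`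
(`ι₀ = m(P,P) ι m(P,P)`, the section law at `m(P,P)` costs `χ(−1)`, and `m(P,P)·g = [PY, PB; 0, PD]·κ` has corner row `(PY)_{1•} = Y_{0•}`, `‖det PY‖ = ‖det Y‖`; §1).  So a block letter for
the A-line must read `Y_σ 0 k`, not `Y_σ 1 k`. [cite: Shimura1997, §16, §18.4] [cite: KudlaRallis1994, §2] [cite: BorelJacquet1979, §1.2, §4.1] -/
theorem norm_corner_lineWhittaker_le_of_blockDecomp_inl
    {χ : ℂ → ℂ} {s : ℂ} {f : Matrix (Fin 2 ⊕ Fin 2) (Fin 2 ⊕ Fin 2) ℂ → ℂ} (hf : IsArchSiegelSection χ s f) (hχ1 : χ 1 = 1)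
    (hχ : ∀ z : ℂ, z ≠ 0 → ‖χ z‖ ≤ 1)
    (hK : ∀ k : Matrix (Fin 2 ⊕ Fin 2) (Fin 2 ⊕ Fin 2) ℂ, kᴴ * Matrix.J (Fin 2) ℂ * k = Matrix.J (Fin 2) ℂ →
      moeb k (I • (1 : Matrix (Fin 2) (Fin 2) ℂ)) = I • 1 → ∃ ρ : ℂ, ‖ρ‖ ≤ 1 ∧ ∀ g, f (g * k) = ρ * f g)
    {CL : ℝ}
    (hline : ∀ h : ℝ, ‖∫ t : ℝ, f (ι (Matrix.J (Fin 1) ℂ * fromBlocks 1 ((t : ℂ) • (1 : Matrix (Fin 1) (Fin 1) ℂ)) 0 1)) *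
        Complex.exp (-(2 * Real.pi * I * h * t))‖ ≤ CL * (1 + |h|) * Real.exp (-(Real.pi * |h|)))
    {Y B D : Matrix (Fin 2) (Fin 2) ℂ} {κ : Matrix (Fin 2 ⊕ Fin 2) (Fin 2 ⊕ Fin 2) ℂ}
    (hg : (fromBlocks Y B 0 D * κ)ᴴ * Matrix.J (Fin 2) ℂ * (fromBlocks Y B 0 D * κ) = Matrix.J (Fin 2) ℂ) (hκ : κ * κᴴ = 1) (hκ' : κᴴ * κ = 1) (μ : ℝ) :
    ‖∫ t : ℝ, f (ι₀ (Matrix.J (Fin 1) ℂ * fromBlocks 1 ((t : ℂ) • (1 : Matrix (Fin 1) (Fin 1) ℂ)) 0 1) * (fromBlocks Y B 0 D * κ)) *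
        Complex.exp (-(2 * Real.pi * I * μ * t))‖ ≤
      CL * (∑ j, ‖Y 0 j‖ ^ 2) ^ (-(2 * s.re + 1)) * ‖Y.det‖ ^ (2 * s.re + 2) *
        ((1 + |μ| * ∑ j, ‖Y 0 j‖ ^ 2) * Real.exp (-(Real.pi * (|μ| * ∑ j, ‖Y 0 j‖ ^ 2)))) := by
  -- the swapped point `g′ = m(P,P) · g = [PY, PB; 0, PD] · κ`
  have hswap : (fromBlocks !![0, 1; 1, 0] 0 0 !![0, 1; 1, 0] : Matrix (Fin 2 ⊕ Fin 2) (Fin 2 ⊕ Fin 2) ℂ) * (fromBlocks Y B 0 D * κ) =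
      fromBlocks (!![0, 1; 1, 0] * Y) (!![0, 1; 1, 0] * B) 0 (!![0, 1; 1, 0] * D) * κ := by
    rw [← Matrix.mul_assoc, fromBlocks_multiply]
    simp
  have hg' : (fromBlocks (!![0, 1; 1, 0] * Y) (!![0, 1; 1, 0] * B) 0 (!![0, 1; 1, 0] * D) * κ)ᴴ * Matrix.J (Fin 2) ℂ *
      (fromBlocks (!![0, 1; 1, 0] * Y) (!![0, 1; 1, 0] * B) 0 (!![0, 1; 1, 0] * D) * κ) = Matrix.J (Fin 2) ℂ := by
    rw [← hswap]; exact K2LiuHermitianTubeCocycle.mul_mem_UJ swap_levi_mem hg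
  -- the section law at `m(P,P)`: the factor `χ(det P) ‖det P‖^{2s+2} = χ(−1)`
  have hdetP : (!![0, 1; 1, 0] : Matrix (Fin 2) (Fin 2) ℂ).det = -1 := by simp [Matrix.det_fin_two]
  have hlaw : ∀ t : ℝ, f (ι₀ (Matrix.J (Fin 1) ℂ * fromBlocks 1 ((t : ℂ) • (1 : Matrix (Fin 1) (Fin 1) ℂ)) 0 1) * (fromBlocks Y B 0 D * κ)) =
      χ (-1) * f (ι (Matrix.J (Fin 1) ℂ * fromBlocks 1 ((t : ℂ) • (1 : Matrix (Fin 1) (Fin 1) ℂ)) 0 1) *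
        (fromBlocks (!![0, 1; 1, 0] * Y) (!![0, 1; 1, 0] * B) 0 (!![0, 1; 1, 0] * D) * κ)) := fun t => by
    rw [cornerInl_eq_conj ι hι ι₀ hι₀, ← hswap, Matrix.mul_assoc, Matrix.mul_assoc,
      hf _ _ swap_levi_mem (toBlocks_fromBlocks₂₁ _ _ _ _), toBlocks_fromBlocks₁₁, hdetP]
    simp
  have hint : (∫ t : ℝ, f (ι₀ (Matrix.J (Fin 1) ℂ * fromBlocks 1 ((t : ℂ) • (1 : Matrix (Fin 1) (Fin 1) ℂ)) 0 1) * (fromBlocks Y B 0 D * κ)) *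
        Complex.exp (-(2 * Real.pi * I * μ * t))) =
      χ (-1) * ∫ t : ℝ, f (ι (Matrix.J (Fin 1) ℂ * fromBlocks 1 ((t : ℂ) • (1 : Matrix (Fin 1) (Fin 1) ℂ)) 0 1) *
        (fromBlocks (!![0, 1; 1, 0] * Y) (!![0, 1; 1, 0] * B) 0 (!![0, 1; 1, 0] * D) * κ)) * Complex.exp (-(2 * Real.pi * I * μ * t)) := by
    rw [← integral_const_mul]
    refine integral_congr_ae (Filter.Eventually.of_forall fun t => ?_)
    simp only [hlaw t]
    ring
  have hB := norm_corner_lineWhittaker_le_of_blockDecomp ι hι hf hχ1 hχ hK hline hg' hκ hκ' μ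
  have hrow : ∑ j, ‖((!![0, 1; 1, 0] : Matrix (Fin 2) (Fin 2) ℂ) * Y) 1 j‖ ^ 2 = ∑ j, ‖Y 0 j‖ ^ 2 := by
    refine Finset.sum_congr rfl fun j _ => ?_
    simp [Matrix.mul_apply, Fin.sum_univ_two]
  have hdet : ‖((!![0, 1; 1, 0] : Matrix (Fin 2) (Fin 2) ℂ) * Y).det‖ = ‖Y.det‖ := by rw [det_mul, hdetP, neg_one_mul, norm_neg]
  rw [hrow, hdet] at hB
  rw [hint, norm_mul]
  have h0 : 0 ≤ ‖∫ t : ℝ, f (ι (Matrix.J (Fin 1) ℂ * fromBlocks 1 ((t : ℂ) • (1 : Matrix (Fin 1) (Fin 1) ℂ)) 0 1) *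
      (fromBlocks (!![0, 1; 1, 0] * Y) (!![0, 1; 1, 0] * B) 0 (!![0, 1; 1, 0] * D) * κ)) * Complex.exp (-(2 * Real.pi * I * μ * t))‖ := norm_nonneg _
  calc ‖χ (-1)‖ * _ ≤ 1 * _ := mul_le_mul_of_nonneg_right (hχ (-1) (by norm_num)) h0
    _ ≤ _ := by rw [one_mul]; exact hB

end Inl


end Summit.HodgeConjecture.HodgeConjecture.Cruxes.HLiu418.K2LiuKindOneLineCornerArchFactor

end
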